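import Mathlib
import Literature.Probability.LatticeModels.TorusFourier
import HarnessLib

/-!
# `ν`-component spin models on the torus: Gibbs measure, infrared bound and long-range order
# (Fröhlich–Simon–Spencer 1976, in the form of Friedli–Velenik 2017, §10.5)

The finite-volume classical `ν`-vector models of Friedli–Velenik, *Statistical Mechanics of Lattice
Systems* (2017), §10.5.1: spins `S_x ∈ ℝ^ν` on the discrete torus `(ℤ/Lℤ)^d`, Hamiltonian
`ℋ_{L;β} = β ∑_{{i,j} ∈ E_L} ‖S_i - S_j‖₂²` (eq. (10.38)), an arbitrary finite, compactly supported
single-spin reference measure `ρ` on `ℝ^ν` and `μ₀ = ⊗ ρ`; the Gibbs distribution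
`μ_{L;β} = e^{-ℋ} μ₀ / Z`. Choosing `ρ` = uniform measure on `𝕊^{ν-1}` gives the O(`ν`) model
(`ν = 2`: plane rotator / XY; Example 10.22), other rotation-invariant `ρ` give soft versions.

Vendored, as ONE named fact `FriedliVelenik2017_nVector_infraredBound` with two clauses:
* the **infrared bound** (Thm. 10.24; originally Fröhlich–Simon–Spencer, CMP 50 (1976), Thm. 3.1
  [FrohlichSimonSpencer1976]): for `p = 2πk/L ≠ 0`,
  `⟨‖Ŝ_p‖₂²⟩_{L;β} = ∑_j e^{ip·j}⟨S_0·S_j⟩ ≤ (ν/4βd){1 - (1/2d)∑_{j∼0} cos(p·j)}⁻¹ = ν/(4β ε(p))`,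
  `ε(p) = ∑ᵢ (1 - cos pᵢ)` (the tree's `dispersion`);
* the **finite-volume long-range-order bound** it implies when `‖S_x‖₂ = 1` `ρ`-a.s. (§10.5.2,
  display after Thm. 10.24): `⟨‖m_L‖₂²⟩_{L;β} ≥ 1 - (ν/4β) |𝕋_L|⁻¹ ∑_{p ≠ 0} ε(p)⁻¹`,
  `m_L = |𝕋_L|⁻¹ ∑_x S_x`; for `d ≥ 3` the Riemann sum stays bounded (Thm. 10.25: `β₀ < ∞`), which
  is orientational long-range order, uniformly in `L`, for `β` large — the classical engine of
  continuous-symmetry breaking.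

## Contents

* `VecConfig d L ν`, `nVectorHamiltonian`, `nVectorRef`, `nVectorPartitionFunction`,
  `nVectorGibbs` (real definitions), with `nVectorHamiltonian_nonneg`,
  `nVectorPartitionFunction_pos` and `isProbabilityMeasure_nVectorGibbs` PROVED;
* `spinFourierNormSq ω k = ‖∑_x e^{-ip·x} S_x‖₂²` (through the tree's `torusFourier`),
  `magnetisationNormSq ω = ‖m_L‖₂²`;
* the named fact.

## Faithfulness / design notes

* Spins are `Fin ν → ℝ` with the Euclidean structure written out in coordinates
  (`∑ a, (S a)²`), avoiding `EuclideanSpace` coercions; the Hamiltonian sums over sites `x` and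
  directions `i` the bond `(x, x + eᵢ)`, which for `L ≥ 3` enumerates each edge of the torus once
  (as `E_L` in (10.38)); Friedli–Velenik take `L` even throughout (Remark 10.4), and we also
  require `4 ≤ L` (for `L = 2` the periodic torus has double bonds; cf. the tree's
  `Literature.Probability.LatticeModels.infraredBound` for the same caveat) — an extra hypothesis,
  so the statement is weaker than printed, never stronger.
* `⟨‖Ŝ_p‖₂²⟩` with FV's normalisation `Ŝ_p = |𝕋_L|^{-1/2} ∑_j e^{ip·j} S_j` is
  `|𝕋_L|⁻¹ ⟨spinFourierNormSq · k⟩` (sign of the phase immaterial inside `‖·‖²`); its equality with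
  `∑_j e^{ip·j}⟨S_0·S_j⟩` is FV's translation-invariance identity before (10.40).
  `{1 - (1/2d)∑_{j∼0} cos(p·j)} = ε(p)/d` since the `2d` neighbours of `0` are `±eᵢ`.
* Compact support of `ρ` is FV's standing assumption (well-definedness of `Z(h)`); the soft
  `φ⁴` single-site weights `e^{-K′(‖S‖²-1)²} dS` of Fröhlich–Simon–Spencer §4 are NOT covered by the
  vended statement (their source is not held; acquisition request acq-01413, cite-only).
* Not transcribed: Thm. 10.25's `β₀` and the `liminf` (a Riemann-sum estimate away from the
  finite-volume clause), Gaussian domination (Prop. 10.27), reflection positivity itself.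

## References

* S. Friedli, Y. Velenik, *Statistical Mechanics of Lattice Systems*, CUP 2017, §10.5.1 (10.38),
  §10.5.2 (10.39)–(10.41), Thm. 10.24, Thm. 10.25, Remark 10.4. [FriedliVelenik2017]
* J. Fröhlich, B. Simon, T. Spencer, *Infrared bounds, phase transitions and continuous symmetry
  breaking*, Comm. Math. Phys. 50 (1976) 79–95, Thm. 3.1 and §4. [FrohlichSimonSpencer1976]
-/

noncomputable section

open MeasureTheory

namespace Literature.Probability.LatticeModels

/-! ### Configurations, Hamiltonian, Gibbs measure -/

/-- Configurations of `ν`-component real spins on the torus `(ℤ/Lℤ)^d`: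
`ω x ∈ ℝ^ν` written as `Fin ν → ℝ` (FV §10.5.1, `Ω₀ = ℝ^ν`). [cite: FriedliVelenik2017, §10.5.1] -/
abbrev VecConfig (d L ν : ℕ) : Type := TorusSite d L → Fin ν → ℝ

variable {d L ν : ℕ}

/-- The Hamiltonian (10.38): `ℋ_{L;β}(ω) = β ∑_x ∑_i ‖ω(x + eᵢ) - ω(x)‖₂²`, the sum over sites and
directions enumerating each nearest-neighbour bond `{x, x + eᵢ}` of the torus once (`L ≥ 3`).
[cite: FriedliVelenik2017, §10.5.1 eq. (10.38)] -/
def nVectorHamiltonian [NeZero L] (β : ℝ) (ω : VecConfig d L ν) : ℝ :=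
  β * ∑ x : TorusSite d L, ∑ i : Fin d, ∑ a : Fin ν, (ω (x + Pi.single i 1) a - ω x a) ^ 2

/-- The Hamiltonian is nonnegative for `β ≥ 0`. [cite: FriedliVelenik2017, §10.5.1] -/
theorem nVectorHamiltonian_nonneg [NeZero L] {β : ℝ} (hβ : 0 ≤ β) (ω : VecConfig d L ν) :
    0 ≤ nVectorHamiltonian β ω :=
  mul_nonneg hβ (Finset.sum_nonneg fun _ _ => Finset.sum_nonneg fun _ _ =>
    Finset.sum_nonneg fun _ _ => sq_nonneg _)

/-- The Hamiltonian is a continuous function of the configuration. [cite: FriedliVelenik2017, §10.5.1] -/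
theorem continuous_nVectorHamiltonian [NeZero L] (β : ℝ) :
    Continuous fun ω : VecConfig d L ν => nVectorHamiltonian β ω := by
  unfold nVectorHamiltonian
  fun_prop

/-- The reference (a priori) measure `μ₀ = ⊗_{x ∈ 𝕋_L} ρ` for a single-spin measure `ρ` on `ℝ^ν`.
[cite: FriedliVelenik2017, §10.5.1] -/
def nVectorRef [NeZero L] (ρ : Measure (Fin ν → ℝ)) : Measure (VecConfig d L ν) :=
  Measure.pi fun _ => ρ

/-- The reference measure is finite when `ρ` is. [cite: FriedliVelenik2017, §10.5.1] -/
instance nVectorRef.instIsFiniteMeasure [NeZero L] (ρ : Measure (Fin ν → ℝ)) [IsFiniteMeasure ρ] :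
    IsFiniteMeasure (nVectorRef (d := d) (L := L) ρ) := by
  unfold nVectorRef
  infer_instance

/-- The partition function `Z_{L;β} = ∫ e^{-ℋ_{L;β}} dμ₀`. [cite: FriedliVelenik2017, §10.5.1] -/
def nVectorPartitionFunction [NeZero L] (ρ : Measure (Fin ν → ℝ)) (β : ℝ) : ℝ :=
  ∫ ω, Real.exp (-nVectorHamiltonian β ω) ∂(nVectorRef (d := d) (L := L) ρ)

/-- The **Gibbs distribution** `μ_{L;β} = Z_{L;β}⁻¹ e^{-ℋ_{L;β}} μ₀` of the `ν`-vector model on the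
torus (FV (10.5) with (10.38)). [cite: FriedliVelenik2017, §10.5.1] -/
def nVectorGibbs [NeZero L] (ρ : Measure (Fin ν → ℝ)) (β : ℝ) : Measure (VecConfig d L ν) :=
  (ENNReal.ofReal (nVectorPartitionFunction (d := d) (L := L) ρ β))⁻¹ •
    (nVectorRef (d := d) (L := L) ρ).withDensity
      fun ω => ENNReal.ofReal (Real.exp (-nVectorHamiltonian β ω))

/-- The Boltzmann weight is integrable against the (finite) reference measure when `β ≥ 0`
(it is continuous and bounded by `1`). [cite: FriedliVelenik2017, §10.5.1] -/
theorem integrable_exp_neg_nVectorHamiltonian [NeZero L] (ρ : Measure (Fin ν → ℝ))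
    [IsFiniteMeasure ρ] {β : ℝ} (hβ : 0 ≤ β) :
    Integrable (fun ω : VecConfig d L ν => Real.exp (-nVectorHamiltonian β ω))
      (nVectorRef (d := d) (L := L) ρ) := by
  refine (integrable_const (1 : ℝ)).mono' ?_ (ae_of_all _ fun ω => ?_)
  · exact ((continuous_nVectorHamiltonian β).neg.rexp).aestronglyMeasurable
  · rw [Real.norm_eq_abs, abs_of_pos (Real.exp_pos _), Real.exp_le_one_iff, neg_nonpos]
    exact nVectorHamiltonian_nonneg hβ ω

/-- The partition function is positive for a nonzero finite reference measure and `β ≥ 0`.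
[cite: FriedliVelenik2017, §10.5.1] -/
theorem nVectorPartitionFunction_pos [NeZero L] (ρ : Measure (Fin ν → ℝ)) [IsFiniteMeasure ρ]
    (hρ : ρ ≠ 0) {β : ℝ} (hβ : 0 ≤ β) :
    0 < nVectorPartitionFunction (d := d) (L := L) ρ β := by
  unfold nVectorPartitionFunction
  rw [integral_pos_iff_support_of_nonneg (fun ω => (Real.exp_pos _).le)
    (integrable_exp_neg_nVectorHamiltonian ρ hβ)]
  have hsupp : Function.support (fun ω : VecConfig d L ν => Real.exp (-nVectorHamiltonian β ω)) =
      Set.univ := by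
    ext ω
    simp [(Real.exp_pos _).ne']
  rw [hsupp, nVectorRef]
  have huniv : (Set.univ : Set (VecConfig d L ν)) = Set.pi Set.univ fun _ => Set.univ := by
    simp
  rw [huniv, Measure.pi_pi]
  refine pos_iff_ne_zero.2 (Finset.prod_ne_zero_iff.2 fun x _ => ?_)
  rwa [Ne, Measure.measure_univ_eq_zero]

/-- The Gibbs distribution is a probability measure (nonzero finite `ρ`, `β ≥ 0`).
[cite: FriedliVelenik2017, §10.5.1] -/
theorem isProbabilityMeasure_nVectorGibbs [NeZero L] (ρ : Measure (Fin ν → ℝ)) [IsFiniteMeasure ρ]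
    (hρ : ρ ≠ 0) {β : ℝ} (hβ : 0 ≤ β) :
    IsProbabilityMeasure (nVectorGibbs (d := d) (L := L) ρ β) := by
  constructor
  have hZ := nVectorPartitionFunction_pos (d := d) (L := L) ρ hρ hβ
  rw [nVectorGibbs, Measure.smul_apply, withDensity_apply _ MeasurableSet.univ,
    Measure.restrict_univ, ← ofReal_integral_eq_lintegral_ofReal
      (integrable_exp_neg_nVectorHamiltonian ρ hβ) (ae_of_all _ fun ω => (Real.exp_pos _).le),
    smul_eq_mul]
  exact ENNReal.inv_mul_cancel (ENNReal.ofReal_pos.2 hZ).ne' ENNReal.ofReal_ne_top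

/-! ### Fourier modes and magnetisation -/

/-- `‖∑_x e^{-ip·x} S_x‖₂² = ∑_a |(S^a)^(k)|²`, the squared norm of the (unnormalised) Fourier mode
`k` (`p = 2πk/L`) of a configuration, through the tree's `torusFourier`; FV's `‖Ŝ_p‖₂²` is
`|𝕋_L|⁻¹` times this. [cite: FriedliVelenik2017, §10.5.2] -/
def spinFourierNormSq [NeZero L] (ω : VecConfig d L ν) (k : TorusSite d L) : ℝ :=
  ∑ a : Fin ν, ‖torusFourier (fun x => (ω x a : ℂ)) k‖ ^ 2

/-- `‖m_L‖₂²` for the magnetisation density `m_L = |𝕋_L|⁻¹ ∑_x S_x`.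
[cite: FriedliVelenik2017, §10.5.2] -/
def magnetisationNormSq [NeZero L] (ω : VecConfig d L ν) : ℝ :=
  ∑ a : Fin ν, ((∑ x : TorusSite d L, ω x a) / (L : ℝ) ^ d) ^ 2

/-! ### The named fact -/

/-- **Infrared bound and finite-volume long-range order for `ν`-vector models**
(Friedli–Velenik 2017, Thm. 10.24 and the display following it in §10.5.2; originally
Fröhlich–Simon–Spencer 1976, Thm. 3.1). For the Gibbs distribution `μ_{L;β}` of (10.38) on the torus
`(ℤ/Lℤ)^d`, `L` even (here also `L ≥ 4`), with a nonzero finite compactly supported single-spin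
measure `ρ` on `ℝ^ν` and `β > 0`:
(1) INFRARED BOUND: for every `k ≠ 0`, with `p = 2πk/L` and `ε(p) = ∑ᵢ (1 - cos pᵢ)`,
`|𝕋_L|⁻¹ ⟨‖∑_x e^{-ip·x} S_x‖₂²⟩_{L;β} ≤ ν / (4 β ε(p))`
(FV: `∑_j e^{ip·j}⟨S_0·S_j⟩ ≤ (ν/4βd){1 - (1/2d)∑_{j∼0} cos(p·j)}⁻¹`, and `{…} = ε(p)/d`);
(2) LONG-RANGE-ORDER BOUND: if moreover `‖S‖₂ = 1` `ρ`-a.s., then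
`⟨‖m_L‖₂²⟩_{L;β} ≥ 1 - (ν/4β) |𝕋_L|⁻¹ ∑_{k ≠ 0} ε(2πk/L)⁻¹`.
[cite: FriedliVelenik2017, Thm. 10.24 and §10.5.2] -/
def FriedliVelenik2017_nVector_infraredBound : Prop :=
  ∀ (d L ν : ℕ) [NeZero L] (_ : Even L) (_ : 4 ≤ L) (ρ : Measure (Fin ν → ℝ)) [IsFiniteMeasure ρ]
    (_ : ∃ K : Set (Fin ν → ℝ), IsCompact K ∧ ρ Kᶜ = 0) (_ : ρ ≠ 0) (β : ℝ) (_ : 0 < β),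
    (∀ k : TorusSite d L, k ≠ 0 →
      (1 / (L : ℝ) ^ d) * ∫ ω, spinFourierNormSq ω k ∂(nVectorGibbs (d := d) (L := L) ρ β) ≤
        ν / (4 * β * dispersion (latticeMomentum L k))) ∧
    ((∀ᵐ s ∂ρ, ∑ a, s a ^ 2 = 1) →
      1 - ν / (4 * β) * ((1 / (L : ℝ) ^ d) *
          ∑ k ∈ (Finset.univ.erase (0 : TorusSite d L)), 1 / dispersion (latticeMomentum L k)) ≤
        ∫ ω, magnetisationNormSq ω ∂(nVectorGibbs (d := d) (L := L) ρ β))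

end Literature.Probability.LatticeModels
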